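/-
Copyright (c) 2026. All rights reserved.
Released under Apache 2.0 license as described in the file LICENSE.
-/
import Literature.NumberTheory.Automorphic.BrandtSetupTwoSidedIdealNorms
import HarnessLib

/-!
# The stabilisers of the sign group `(ℤ/2ℤ)^T` on `Cls O` are type invariants, and the fibre of the type map
# `Cls O → Typ O` over the type of `O' = O_L(I)` has `2^{ω(N⁺N⁻)} / z` classes, `z` = the number of principal admissible
# two-sided ideals of `O'` (Voight Lemma 18.5.1, Prop. 18.5.3, (18.5.8), Prop. 18.5.10, Cor. 18.5.12; Martin Prop. 7)

[tag: quaternion_algebra] [tag: eichler_order] [tag: class_number] [tag: hecke_operator]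

Topic `NumberTheory/Automorphic`; THEOREMS ONLY (no definition, no named fact, no instance, no notation; net debt `0`).
Lane `lit-hodgefound`, seat p12, gen 53 — sequel of `BrandtSetupTwoSidedIdealNorms.lean` (#4) on top of
`QuaternionicSIdealClasses.lean` (orbit–stabiliser and Burnside for the sign group) and
`QuaternionicSIdealClassesAdmissible.lean` (Martin's `χ`-admissible classes).

THE PRINTED STATEMENTS (J. Voight, *Quaternion Algebras*, GTM 288, §18.5). **Lemma 18.5.1**: `1 → O^× → N_{B^×}(O) →
PIdl(O) → 1`, `α ↦ OαO`. **Prop. 18.5.3**: `N_{B^×}(O)/(F^×O^×) ≅ PIdl(O)/PIdl(R)`. **(18.5.8)**: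
`#(Idl(O)/PIdl(O)) · #(N_{B^×}(O)/(F^×O^×)) = #Pic_R(O)`. **Prop. 18.5.10**: `J' ↦ [J'I]` induces a bijection
`PIdl(O') \ Idl(O') ↔ {[I'] ∈ Cls O : O_L(I') ≃ O'}` — the fibre of `Cls O → Typ O` over the type of `O' = O_L(I)`.
**Cor. 18.5.12**: `#Cls O = Σ_{[O'] ∈ Typ O} [Idl(O') : PIdl(O')] = #Pic_R(O) · Σ_{[O']} 1/z_{O'}`, `z_{O'} = [N_{B^×}(O') :
F^×O'^×]`. **(23.4.20)** (Eichler order of level `𝔐`, `discrd O = 𝔑 = 𝔇𝔐`): `Idl(O)/Idl(R) ≅ ∏_{𝔭 ∣ 𝔑} ℤ/2ℤ`, so over `ℤ`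
`#Pic(O) = 2^{ω(N⁺N⁻)}`. K. Martin, *Canad. J. Math.* 70 (2018) §4.4 **Prop. 7**: `dim M^χ(O) = #{χ-admissible classes}`,
a class being admissible iff `χ` is trivial on its stabiliser in the sign group.

For a Brandt setup `S : XiSetup N⁺ N⁻` (definite algebra `D` of discriminant `N⁻`, Eichler order `O` of level `N⁺`) the
tree has: the sign group `Φ_T : (ℤ/2ℤ)^T → Sym(Cls O)` (`XiSetup.atkinLehnerHom`), its orbits `Cl_T(O)` (`sClassOf`; they
are the fibres of `typeOf` when `T ⊇ primes(N⁺N⁻)`), orbit–stabiliser `#X · #Stab = 2^{#T}`, admissibility ⟺ `χ = 1` on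
the stabiliser, and (#4) **the stabiliser in arithmetic form**: `Φ_T(g) c = c ⟺ ∃ x ∈ O_L(I_c) P_{supp g}(O_L(I_c))` with
`nrd x = ∏_{r ∈ supp g} localNorm r` (`P_l(O') = ∏_{r ∈ l} T_r(O')`, `T_r = 𝔓_r` or `𝔔_{r^{v_r N⁺}}`). This file proves:

* §1 **`Φ_T(g)` and `Φ_{T'}(g')` commute**, hence **the stabiliser of `c` in `(ℤ/2ℤ)^T` depends only on the TYPE of
  `c`** (`XiSetup.atkinLehnerHom_apply_eq_self_iff_of_typeOf_eq`; Voight: it is `PIdl(O')/PIdl(ℤ) ≅ N(O')/ℚ^×O'^×`, an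
  invariant of the isomorphism class of `O' = O_L(I_c)`), and classes of one type have `T`-classes of one size;
* §2 the arithmetic form: **for classes `c, c'` of the same type, `O_L(I_c) P_l(O_L(I_c))` contains an element of reduced
  norm `∏_{r ∈ l} localNorm r` iff `O_L(I_{c'}) P_l(O_L(I_{c'}))` does** (`XiSetup.exists_norm_iff_of_typeOf_eq`);
* §3 **THE FIBRES OF THE TYPE MAP (Voight (18.5.8) ∕ Prop. 18.5.10 ∕ (23.4.20)):
  `#{c' : typeOf c' = typeOf c} · #{g ∈ (ℤ/2ℤ)^T : ∃ x ∈ O_L(I_c) P_{supp g}(O_L(I_c)), nrd x = ∏ localNorm} = 2^{#T}`**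
  for `T ⊇ primes(N⁺N⁻)` (`XiSetup.natCard_fibre_mul_natCard_norm_eq_two_pow`); every fibre has `2^m` elements with
  `m ≤ ω(N⁺N⁻)`; it has `2^{ω(N⁺N⁻)}` elements iff NO non-empty admissible product of `O_L(I_c)` is principal, and ONE
  element iff ALL of them are; `#Cls O = Σ_{t ∈ Typ O} #fibre(t)` and `Σ_{c ∈ Cls O} z(c) = 2^{#T} · #Typ O` (Cor. 18.5.12);
* §4 **admissibility in arithmetic form** (`XiSetup.isAdmissible_sClassOf_iff_forall_norm`), its type invariance, and
  **MARTIN'S PROP. 7 OVER THE TYPE SET: `dim M^χ(O) = #{t ∈ Typ O : χ(g) = 1 whenever O_L(I_c) P_{supp g}(O_L(I_c))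
  contains an element of reduced norm ∏ localNorm (typeOf c = t)}`** for `T ⊇ primes(N⁺N⁻)`
  (`XiSetup.finrank_signSpace_eq_natCard_typeSet_norm`);
* §5 **the principal type**: `(W_{r_k} ∘ ⋯ ∘ W_{r_1}) [O] = [O] ⟺ ∃ x ∈ O P_l(O), nrd x = ∏ localNorm`; the classes with
  `O_L(I_c) ≃ O` are exactly the `[O P_{supp g}(O)]`, and **`#{c : O_L(I_c) ≃ O} · #{g : ∃ x ∈ O P_{supp g}(O), nrd x =
  ∏ localNorm} = 2^{#T}`** (`#(PIdl(O) \ Idl(O)) · [N(O) : ℚ^×O^×] = 2^{ω(N⁺N⁻)}`, Prop. 18.5.10 at `I = O`);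
* §6 **EICHLER'S CLASS NUMBER OVER THE TYPES (Cor. 18.5.12, second form): `#Cls O = Σ_{t ∈ Typ O} 2^{#T} / z_t`** with the type
  invariant `z_t = #{g : O_L(I_c) P_{supp g}(O_L(I_c)) has an element of reduced norm ∏ localNorm (typeOf c = t)}`
  (`XiSetup.natCard_classSet_eq_sum_two_pow_div_natCard_typeNorm`), and `#Cls O = 2^{#T} · #Typ O` iff every `z = 1`.

## References

* [Voight2021] J. Voight, *Quaternion Algebras*, GTM 288 (2021): Lemma 18.5.1, Prop. 18.5.3, (18.5.8), Prop. 18.5.10,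
  Cor. 18.5.12, Remark 18.5.14, Lemma 17.4.13, (23.4.20).
* [VignerasLNM800] M.-F. Vignéras, *Arithmétique des algèbres de quaternions*, LNM 800 (1980), Ch. III §5 (idéaux bilatères,
  nombre de types; exercice 5.8).
* [Martin2018] K. Martin, *Congruences for modular forms mod 2 and quaternionic `S`-ideal classes*, Canad. J. Math. 70 (2018),
  §4.4 Prop. 7, Cor. 8, Lemma 9.
* [Martin2018RefinedDimensions] K. Martin, *Refined dimensions of cusp forms, and equidistribution and bias of signs*,
  J. Number Theory 188 (2018), §3 Prop. 12.

## Scope (honest)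

Theorems only. The arithmetic stabiliser is identified with `N(O')/ℚ^×O'^×` only through its cardinality (orbit–stabiliser),
not as a group (Voight Prop. 18.5.3); the fibre sizes are not evaluated in closed form.
-/

noncomputable section

open scoped Pointwise

universe u

namespace Literature.NumberTheory.Automorphic

open AtkinLehner

namespace Brandt

variable {Nplus Nminus : ℕ} (S : XiSetup Nplus Nminus) (T : Finset ℕ)

/-! ## §1 The sign groups commute; stabilisers are type invariants -/

/-- **`Φ_T(g)` and `Φ_{T'}(g')` commute** (all the `W_r` commute; `Idl(O)/PIdl(ℤ)` is abelian for an Eichler order).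
[cite: Martin2018, §4.4 (Lemma 9)] [cite: Voight2021, (23.4.20)] -/
theorem XiSetup.commute_atkinLehnerHom (T' : Finset ℕ) (g : T → Multiplicative (ZMod 2))
    (g' : T' → Multiplicative (ZMod 2)) : Commute (S.atkinLehnerHom T g) (S.atkinLehnerHom T' g') := by
  classical
  unfold XiSetup.atkinLehnerHom
  rw [MonoidHom.noncommPiCoprod_apply, MonoidHom.noncommPiCoprod_apply]
  refine Finset.noncommProd_commute _ _ _ _ fun r' _ => ?_
  refine (Finset.noncommProd_commute _ _ _ _ fun r _ => ?_).symm
  exact S.commute_atkinLehnerPowHom _ _ _ _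

/-- `Φ_T(g) (Φ_{T'}(g') c) = Φ_{T'}(g') (Φ_T(g) c)`. [cite: Martin2018, §4.4 (Lemma 9)] -/
theorem XiSetup.atkinLehnerHom_atkinLehnerHom_comm (T' : Finset ℕ) (g : T → Multiplicative (ZMod 2))
    (g' : T' → Multiplicative (ZMod 2)) (c : ClassSet S.O) :
    S.atkinLehnerHom T g (S.atkinLehnerHom T' g' c) = S.atkinLehnerHom T' g' (S.atkinLehnerHom T g c) := by
  have h := congrArg (fun σ : Equiv.Perm (ClassSet S.O) => σ c) (S.commute_atkinLehnerHom T T' g g').eq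
  simpa only [Equiv.Perm.coe_mul, Function.comp_apply] using h

/-- `W_r (Φ_T(g) c) = Φ_T(g) (W_r c)` for every `r`. [cite: Martin2018, §4.4 Lemma 9] -/
theorem XiSetup.atkinLehner_atkinLehnerHom_comm (r : ℕ) (g : T → Multiplicative (ZMod 2)) (c : ClassSet S.O) :
    S.atkinLehner r (S.atkinLehnerHom T g c) = S.atkinLehnerHom T g (S.atkinLehner r c) := by
  have h1 : S.atkinLehnerHom {r} (Pi.mulSingle ⟨r, Finset.mem_singleton_self r⟩ (Multiplicative.ofAdd 1))
      (S.atkinLehnerHom T g c) = S.atkinLehner r (S.atkinLehnerHom T g c) :=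
    S.atkinLehnerHom_mulSingle {r} ⟨r, Finset.mem_singleton_self r⟩ _
  have h2 : S.atkinLehnerHom {r} (Pi.mulSingle ⟨r, Finset.mem_singleton_self r⟩ (Multiplicative.ofAdd 1)) c =
      S.atkinLehner r c :=
    S.atkinLehnerHom_mulSingle {r} ⟨r, Finset.mem_singleton_self r⟩ _
  rw [← h1, ← h2, S.atkinLehnerHom_atkinLehnerHom_comm]

/-- The iterated involutions `W_{r_k} ∘ ⋯ ∘ W_{r_1}` commute with `Φ_T(g)`. [cite: Martin2018, §4.4 Lemma 9] -/
theorem XiSetup.foldl_atkinLehner_atkinLehnerHom_comm (l : List ℕ) (g : T → Multiplicative (ZMod 2)) (c : ClassSet S.O) :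
    l.foldl (fun c r => S.atkinLehner r c) (S.atkinLehnerHom T g c) =
      S.atkinLehnerHom T g (l.foldl (fun c r => S.atkinLehner r c) c) := by
  induction l generalizing c with
  | nil => rfl
  | cons r l ih => rw [List.foldl_cons, List.foldl_cons, S.atkinLehner_atkinLehnerHom_comm, ih]

/-- **The stabiliser of `c` in `(ℤ/2ℤ)^T` depends only on the `T'`-class of `c`** (any `T, T'`: in an abelian group the
stabilisers along an orbit coincide). [cite: Martin2018, §4.4 (remark after Lemma 9)] [cite: Voight2021, Prop. 18.5.10] -/
theorem XiSetup.atkinLehnerHom_apply_eq_self_iff_of_sClassOf_eq {T' : Finset ℕ} {c c' : ClassSet S.O}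
    (h : S.sClassOf T' c = S.sClassOf T' c') (g : T → Multiplicative (ZMod 2)) :
    S.atkinLehnerHom T g c = c ↔ S.atkinLehnerHom T g c' = c' := by
  obtain ⟨g₀, rfl⟩ := (S.sClassOf_eq_sClassOf_iff_exists_atkinLehnerHom T' c c').mp h
  rw [S.atkinLehnerHom_atkinLehnerHom_comm T T' g g₀ c]
  exact (Equiv.apply_eq_iff_eq _).symm

/-- The same for the iterated involutions `W_{r_k} ∘ ⋯ ∘ W_{r_1}`. [cite: Martin2018, §4.4 (remark after Lemma 9)] -/
theorem XiSetup.foldl_atkinLehner_eq_self_iff_of_sClassOf_eq {T' : Finset ℕ} {c c' : ClassSet S.O}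
    (h : S.sClassOf T' c = S.sClassOf T' c') (l : List ℕ) :
    l.foldl (fun c r => S.atkinLehner r c) c = c ↔ l.foldl (fun c r => S.atkinLehner r c) c' = c' := by
  obtain ⟨g₀, rfl⟩ := (S.sClassOf_eq_sClassOf_iff_exists_atkinLehnerHom T' c c').mp h
  rw [S.foldl_atkinLehner_atkinLehnerHom_comm T' l g₀ c]
  exact (Equiv.apply_eq_iff_eq _).symm

/-- **The stabiliser of `c` in `(ℤ/2ℤ)^T` depends only on the TYPE of `c`** (the fibres of the type map are the orbits of
the full sign group; Voight: the stabiliser is `PIdl(O')/PIdl(ℤ)`, `O' = O_L(I_c)`). [cite: Voight2021, Prop. 18.5.10 and Prop. 18.5.3] [cite: Martin2018, §4.4] -/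
theorem XiSetup.atkinLehnerHom_apply_eq_self_iff_of_typeOf_eq {c c' : ClassSet S.O} (h : typeOf S.O c = typeOf S.O c')
    (g : T → Multiplicative (ZMod 2)) : S.atkinLehnerHom T g c = c ↔ S.atkinLehnerHom T g c' = c' :=
  S.atkinLehnerHom_apply_eq_self_iff_of_sClassOf_eq T
    ((S.sClassOf_eq_sClassOf_iff_typeOf_eq (Nplus * Nminus).primeFactors subset_rfl c c').mpr h) g

/-- The same for the iterated involutions. [cite: Voight2021, Prop. 18.5.10] -/
theorem XiSetup.foldl_atkinLehner_eq_self_iff_of_typeOf_eq {c c' : ClassSet S.O} (h : typeOf S.O c = typeOf S.O c')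
    (l : List ℕ) : l.foldl (fun c r => S.atkinLehner r c) c = c ↔ l.foldl (fun c r => S.atkinLehner r c) c' = c' :=
  S.foldl_atkinLehner_eq_self_iff_of_sClassOf_eq
    ((S.sClassOf_eq_sClassOf_iff_typeOf_eq (Nplus * Nminus).primeFactors subset_rfl c c').mpr h) l

/-- Classes of the same type have stabilisers of the same order. [cite: Voight2021, Prop. 18.5.3 and Prop. 18.5.10] -/
theorem XiSetup.natCard_stabilizer_eq_of_typeOf_eq {c c' : ClassSet S.O} (h : typeOf S.O c = typeOf S.O c') :
    Nat.card {g : T → Multiplicative (ZMod 2) // S.atkinLehnerHom T g c = c} =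
      Nat.card {g : T → Multiplicative (ZMod 2) // S.atkinLehnerHom T g c' = c'} :=
  Nat.card_congr (Equiv.subtypeEquivRight fun g => S.atkinLehnerHom_apply_eq_self_iff_of_typeOf_eq T h g)

/-- The stabiliser is non-empty (it contains `1`) and finite. [cite: Martin2018, §4.4] -/
private theorem XiSetup.natCard_stabilizer_pos₅₇ (c : ClassSet S.O) :
    0 < Nat.card {g : T → Multiplicative (ZMod 2) // S.atkinLehnerHom T g c = c} :=
  Nat.card_pos_iff.mpr ⟨⟨⟨1, by rw [map_one, Equiv.Perm.coe_one, id_eq]⟩⟩, inferInstance⟩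

/-- **Classes of the same type have `T`-classes of the same size** (orbit–stabiliser). [cite: Martin2018, §4.4 (remark after Lemma 9)] [cite: Voight2021, Prop. 18.5.10] -/
theorem XiSetup.natCard_sClass_eq_of_typeOf_eq {c c' : ClassSet S.O} (h : typeOf S.O c = typeOf S.O c') :
    Nat.card {x : ClassSet S.O // S.sClassOf T x = S.sClassOf T c} =
      Nat.card {x : ClassSet S.O // S.sClassOf T x = S.sClassOf T c'} := by
  have h1 := S.natCard_sClass_mul_natCard_stabilizer T c
  have h2 := S.natCard_sClass_mul_natCard_stabilizer T c'
  rw [S.natCard_stabilizer_eq_of_typeOf_eq T h] at h1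
  exact Nat.eq_of_mul_eq_mul_right (S.natCard_stabilizer_pos₅₇ T c') (h1.trans h2.symm)

/-! ## §2 The arithmetic form: principal admissible products are a type invariant -/

/-- **For classes `c, c'` of the same type, `O_L(I_c) P_l(O_L(I_c))` contains an element of reduced norm `∏_{r ∈ l} localNorm r`
iff `O_L(I_{c'}) P_l(O_L(I_{c'}))` does** (`l` a duplicate-free list of primes): whether the admissible two-sided ideal
`∏_{r ∈ l} T_r` is principal is an invariant of the isomorphism class of the Eichler order. [cite: Voight2021, Lemma 18.5.1 and Prop. 18.5.10] -/
theorem XiSetup.exists_norm_iff_of_typeOf_eq {l : List ℕ} (hl : ∀ r ∈ l, r.Prime) (hnd : l.Nodup) {c c' : ClassSet S.O}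
    (h : typeOf S.O c = typeOf S.O c') :
    (∃ x ∈ leftOrder c.rep * S.twoSidedIdealProd (leftOrder c.rep) l,
        reducedNorm ℚ S.D x = ((l.map (localNorm Nplus Nminus)).prod : ℕ)) ↔
      ∃ x ∈ leftOrder c'.rep * S.twoSidedIdealProd (leftOrder c'.rep) l,
        reducedNorm ℚ S.D x = ((l.map (localNorm Nplus Nminus)).prod : ℕ) := by
  rw [← S.foldl_atkinLehner_eq_self_iff_exists_reducedNorm_eq hl hnd c,
    ← S.foldl_atkinLehner_eq_self_iff_exists_reducedNorm_eq hl hnd c']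
  exact S.foldl_atkinLehner_eq_self_iff_of_typeOf_eq h l

/-- The count of the principal admissible products (`z(c) = #{g : ∃ x ∈ O_L(I_c) P_{supp g}(O_L(I_c)), nrd x = ∏ localNorm}`,
Voight's `z_{O'} = [N(O') : ℚ^× O'^×]`) is a type invariant. [cite: Voight2021, Prop. 18.5.3 and Cor. 18.5.12] -/
theorem XiSetup.natCard_norm_eq_of_typeOf_eq (hT : ∀ r ∈ T, r.Prime) {c c' : ClassSet S.O} (h : typeOf S.O c = typeOf S.O c') :
    Nat.card {g : T → Multiplicative (ZMod 2) //
        ∃ x ∈ leftOrder c.rep * S.twoSidedIdealProd (leftOrder c.rep) (suppSort T g),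
          reducedNorm ℚ S.D x = (((suppSort T g).map (localNorm Nplus Nminus)).prod : ℕ)} =
      Nat.card {g : T → Multiplicative (ZMod 2) //
        ∃ x ∈ leftOrder c'.rep * S.twoSidedIdealProd (leftOrder c'.rep) (suppSort T g),
          reducedNorm ℚ S.D x = (((suppSort T g).map (localNorm Nplus Nminus)).prod : ℕ)} :=
  Nat.card_congr (Equiv.subtypeEquivRight fun g =>
    S.exists_norm_iff_of_typeOf_eq (fun _ hr => prime_of_mem_suppSort T hT g hr) (nodup_suppSort T g) h)

/-! ## §3 The fibres of the type map `Cls O → Typ O` -/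

/-- **`#{c' : typeOf c' = typeOf c} · #Stab(c) = 2^{#T}`** for `T ⊇ primes(N⁺N⁻)` (orbit–stabiliser; the fibre over the type
of `c` is the orbit of `c` under the full sign group). [cite: Voight2021, Prop. 18.5.10 and (18.5.8)] [cite: Martin2018, §4.4] -/
theorem XiSetup.natCard_fibre_mul_natCard_stabilizer_eq_two_pow (hT : (Nplus * Nminus).primeFactors ⊆ T) (c : ClassSet S.O) :
    Nat.card {c' : ClassSet S.O // typeOf S.O c' = typeOf S.O c} *
        Nat.card {g : T → Multiplicative (ZMod 2) // S.atkinLehnerHom T g c = c} = 2 ^ T.card := by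
  rw [← S.natCard_sClass_mul_natCard_stabilizer T c]
  congr 1
  exact Nat.card_congr (Equiv.subtypeEquivRight fun c' => (S.sClassOf_eq_sClassOf_iff_typeOf_eq T hT c' c).symm)

/-- **VOIGHT (18.5.8) WITH PROP. 18.5.10 AND (23.4.20), ARITHMETIC FORM:
`#{c' : typeOf c' = typeOf c} · #{g ∈ (ℤ/2ℤ)^T : ∃ x ∈ O_L(I_c) P_{supp g}(O_L(I_c)), nrd x = ∏_{supp g} localNorm} = 2^{#T}`**
for every finite set `T ⊇ primes(N⁺N⁻)` of primes — `[Idl(O') : PIdl(O')] · [N(O') : ℚ^×O'^×] = #Pic(O') = 2^{ω(N⁺N⁻)}` for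
`O' = O_L(I_c)` (the extra `r ∤ N⁺N⁻` in `T` act trivially and double both the group and the stabiliser).
[cite: Voight2021, (18.5.8), Prop. 18.5.10 and (23.4.20)] -/
theorem XiSetup.natCard_fibre_mul_natCard_norm_eq_two_pow (hT : (Nplus * Nminus).primeFactors ⊆ T) (hTp : ∀ r ∈ T, r.Prime)
    (c : ClassSet S.O) :
    Nat.card {c' : ClassSet S.O // typeOf S.O c' = typeOf S.O c} *
        Nat.card {g : T → Multiplicative (ZMod 2) //
          ∃ x ∈ leftOrder c.rep * S.twoSidedIdealProd (leftOrder c.rep) (suppSort T g),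
            reducedNorm ℚ S.D x = (((suppSort T g).map (localNorm Nplus Nminus)).prod : ℕ)} = 2 ^ T.card := by
  rw [← S.natCard_fibre_mul_natCard_stabilizer_eq_two_pow T hT c]
  congr 1
  exact Nat.card_congr (Equiv.subtypeEquivRight fun g =>
    (S.atkinLehnerHom_apply_eq_self_iff_exists_reducedNorm_eq T hTp g c (nodup_suppSort T g) (mem_suppSort_iff T g)).symm)

/-- Every fibre of the type map is non-empty. [cite: Voight2021, Lemma 17.4.13] -/
theorem XiSetup.natCard_fibre_typeOf_pos (c : ClassSet S.O) : 0 < Nat.card {c' : ClassSet S.O // typeOf S.O c' = typeOf S.O c} :=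
  Nat.card_pos_iff.mpr ⟨⟨⟨c, rfl⟩⟩, inferInstance⟩

/-- **`#{c' : typeOf c' = typeOf c} ∣ 2^{ω(N⁺N⁻)}`** (`= [Idl(O') : PIdl(O')]`, a quotient of `(ℤ/2ℤ)^{ω(N)}`).
[cite: Voight2021, Prop. 18.5.10 and (23.4.20)] -/
theorem XiSetup.natCard_fibre_typeOf_dvd_two_pow (c : ClassSet S.O) :
    Nat.card {c' : ClassSet S.O // typeOf S.O c' = typeOf S.O c} ∣ 2 ^ (Nplus * Nminus).primeFactors.card :=
  Dvd.intro _ (S.natCard_fibre_mul_natCard_stabilizer_eq_two_pow _ subset_rfl c)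

/-- Every fibre of the type map has `2^m` elements, `m ≤ ω(N⁺N⁻)`. [cite: Voight2021, Prop. 18.5.10 and (23.4.20)] -/
theorem XiSetup.exists_natCard_fibre_typeOf_eq_two_pow (c : ClassSet S.O) :
    ∃ m ≤ (Nplus * Nminus).primeFactors.card, Nat.card {c' : ClassSet S.O // typeOf S.O c' = typeOf S.O c} = 2 ^ m :=
  (Nat.dvd_prime_pow Nat.prime_two).mp (S.natCard_fibre_typeOf_dvd_two_pow c)

/-- `#{c' : typeOf c' = typeOf c} ≤ 2^{ω(N⁺N⁻)}`. [cite: Voight2021, Cor. 18.5.12] -/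
theorem XiSetup.natCard_fibre_typeOf_le_two_pow (c : ClassSet S.O) :
    Nat.card {c' : ClassSet S.O // typeOf S.O c' = typeOf S.O c} ≤ 2 ^ (Nplus * Nminus).primeFactors.card :=
  Nat.le_of_dvd (pow_pos two_pos _) (S.natCard_fibre_typeOf_dvd_two_pow c)

/-- `A · Z = M` with `A, Z > 0`: `A = M ↔ Z = 1` and `A = 1 ↔ Z = M`. [folklore] -/
private theorem eq_iff_of_mul_eq₅₇ {A Z M : ℕ} (h : A * Z = M) (hA : 0 < A) (hZ : 0 < Z) :
    (A = M ↔ Z = 1) ∧ (A = 1 ↔ Z = M) := by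
  subst h
  refine ⟨⟨fun hA' => Nat.eq_of_mul_eq_mul_left hA (by rw [mul_one]; exact hA'.symm), fun hZ1 => by rw [hZ1, mul_one]⟩,
    ⟨fun hA1 => by rw [hA1, one_mul], fun hZ' => Nat.eq_of_mul_eq_mul_right hZ (by rw [one_mul]; exact hZ'.symm)⟩⟩

/-- `#{g // P g} = 1 ↔` only `1` satisfies `P` (given `P 1`). [folklore] -/
private theorem natCard_subtype_eq_one_iff₅₇ {G : Type*} [One G] {P : G → Prop} (h1 : P 1) :
    Nat.card {g // P g} = 1 ↔ ∀ g, P g → g = 1 := by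
  rw [Nat.card_eq_one_iff_exists]
  constructor
  · rintro ⟨x, hx⟩ g hg
    exact congrArg Subtype.val ((hx ⟨g, hg⟩).trans (hx ⟨1, h1⟩).symm)
  · intro h
    exact ⟨⟨1, h1⟩, fun y => Subtype.ext (h y.1 y.2)⟩

/-- `#{g // P g} = #G ↔` every `g` satisfies `P` (`G` finite). [folklore] -/
private theorem natCard_subtype_eq_card_iff₅₇ {G : Type*} [Finite G] (P : G → Prop) :
    Nat.card {g // P g} = Nat.card G ↔ ∀ g, P g := by
  constructor
  · intro h
    by_contra hne
    obtain ⟨g, hg⟩ := not_forall.mp hne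
    exact absurd h (Finite.card_subtype_lt hg).ne
  · intro h
    exact Nat.card_congr (Equiv.subtypeUnivEquiv h)

/-- The order of the sign group `(ℤ/2ℤ)^T`. [cite: Martin2018, §4.4] -/
private theorem natCard_signGroup₅₇ : Nat.card (T → Multiplicative (ZMod 2)) = 2 ^ T.card := by
  rw [Nat.card_eq_fintype_card, Fintype.card_fun, Fintype.card_multiplicative, ZMod.card, Fintype.card_coe]

/-- **The fibre has `2^{#T}` classes iff the stabiliser is trivial** (`T ⊇ primes(N⁺N⁻)`). [cite: Voight2021, (18.5.8) and Prop. 18.5.10] -/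
theorem XiSetup.natCard_fibre_typeOf_eq_two_pow_iff_forall_eq_one (hT : (Nplus * Nminus).primeFactors ⊆ T) (c : ClassSet S.O) :
    Nat.card {c' : ClassSet S.O // typeOf S.O c' = typeOf S.O c} = 2 ^ T.card ↔
      ∀ g : T → Multiplicative (ZMod 2), S.atkinLehnerHom T g c = c → g = 1 := by
  rw [(eq_iff_of_mul_eq₅₇ (S.natCard_fibre_mul_natCard_stabilizer_eq_two_pow T hT c) (S.natCard_fibre_typeOf_pos c)
      (S.natCard_stabilizer_pos₅₇ T c)).1]
  exact natCard_subtype_eq_one_iff₅₇ (P := fun g : T → Multiplicative (ZMod 2) => S.atkinLehnerHom T g c = c)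
    (by rw [map_one, Equiv.Perm.coe_one, id_eq])

/-- **The fibre is a single class iff the stabiliser is everything** (`T ⊇ primes(N⁺N⁻)`). [cite: Voight2021, (18.5.8) and Prop. 18.5.10] -/
theorem XiSetup.natCard_fibre_typeOf_eq_one_iff_forall_eq_self (hT : (Nplus * Nminus).primeFactors ⊆ T) (c : ClassSet S.O) :
    Nat.card {c' : ClassSet S.O // typeOf S.O c' = typeOf S.O c} = 1 ↔
      ∀ g : T → Multiplicative (ZMod 2), S.atkinLehnerHom T g c = c := by
  rw [(eq_iff_of_mul_eq₅₇ (S.natCard_fibre_mul_natCard_stabilizer_eq_two_pow T hT c) (S.natCard_fibre_typeOf_pos c)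
      (S.natCard_stabilizer_pos₅₇ T c)).2, ← natCard_signGroup₅₇ T]
  exact natCard_subtype_eq_card_iff₅₇ _

/-- **ARITHMETIC: the fibre over the type of `O' = O_L(I_c)` has the maximal size `2^{#T}` iff NO non-empty admissible product
`P_{supp g}(O')`, `g ≠ 0`, contains an element of reduced norm `∏ localNorm`** (i.e. none is principal: `N(O') = ℚ^× O'^×`).
[cite: Voight2021, (18.5.8), Prop. 18.5.3 and Prop. 18.5.10] -/
theorem XiSetup.natCard_fibre_typeOf_eq_two_pow_iff_forall_not_exists_norm (hT : (Nplus * Nminus).primeFactors ⊆ T)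
    (hTp : ∀ r ∈ T, r.Prime) (c : ClassSet S.O) :
    Nat.card {c' : ClassSet S.O // typeOf S.O c' = typeOf S.O c} = 2 ^ T.card ↔
      ∀ g : T → Multiplicative (ZMod 2), g ≠ 1 →
        ¬ ∃ x ∈ leftOrder c.rep * S.twoSidedIdealProd (leftOrder c.rep) (suppSort T g),
            reducedNorm ℚ S.D x = (((suppSort T g).map (localNorm Nplus Nminus)).prod : ℕ) := by
  rw [S.natCard_fibre_typeOf_eq_two_pow_iff_forall_eq_one T hT c]
  refine forall_congr' fun g => ?_
  rw [S.atkinLehnerHom_apply_eq_self_iff_exists_reducedNorm_eq T hTp g c (nodup_suppSort T g) (mem_suppSort_iff T g)]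
  exact ⟨fun h hg hx => hg (h hx), fun h hx => by_contra fun hg => h hg hx⟩

/-- **ARITHMETIC: the fibre over the type of `O' = O_L(I_c)` is a single class iff EVERY admissible product `P_{supp g}(O')`
contains an element of reduced norm `∏ localNorm`** (all of `Idl(O')` principal). [cite: Voight2021, (18.5.8), Prop. 18.5.3 and Prop. 18.5.10] -/
theorem XiSetup.natCard_fibre_typeOf_eq_one_iff_forall_exists_norm (hT : (Nplus * Nminus).primeFactors ⊆ T)
    (hTp : ∀ r ∈ T, r.Prime) (c : ClassSet S.O) :
    Nat.card {c' : ClassSet S.O // typeOf S.O c' = typeOf S.O c} = 1 ↔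
      ∀ g : T → Multiplicative (ZMod 2),
        ∃ x ∈ leftOrder c.rep * S.twoSidedIdealProd (leftOrder c.rep) (suppSort T g),
          reducedNorm ℚ S.D x = (((suppSort T g).map (localNorm Nplus Nminus)).prod : ℕ) := by
  rw [S.natCard_fibre_typeOf_eq_one_iff_forall_eq_self T hT c]
  exact forall_congr' fun g =>
    S.atkinLehnerHom_apply_eq_self_iff_exists_reducedNorm_eq T hTp g c (nodup_suppSort T g) (mem_suppSort_iff T g)

/-- **Cor. 18.5.12, first form: `#Cls O = Σ_{t ∈ Typ O} #{c : typeOf c = t}`** (the class set fibred over the type set).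
[cite: Voight2021, Cor. 18.5.12 and Lemma 17.4.13] -/
theorem XiSetup.natCard_classSet_eq_sum_natCard_fibre [Fintype (ClassSet S.O)] [Fintype (TypeSet S.O)] :
    Nat.card (ClassSet S.O) = ∑ t : TypeSet S.O, Nat.card {c : ClassSet S.O // typeOf S.O c = t} := by
  classical
  rw [Nat.card_eq_fintype_card, ← Fintype.card_congr (Equiv.sigmaFiberEquiv (typeOf S.O)), Fintype.card_sigma]
  exact Finset.sum_congr rfl fun t _ => Nat.card_eq_fintype_card.symm

/-- Double counting: `Σ_c #Stab(c) = Σ_g #Fix(Φ_T g)`. [cite: Martin2018, §4.4] -/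
private theorem XiSetup.sum_natCard_stabilizer_eq_sum_natCard_fixedPoints₅₇ [Fintype (ClassSet S.O)] :
    ∑ c : ClassSet S.O, Nat.card {g : T → Multiplicative (ZMod 2) // S.atkinLehnerHom T g c = c} =
      ∑ g : T → Multiplicative (ZMod 2), Nat.card {c : ClassSet S.O // S.atkinLehnerHom T g c = c} := by
  classical
  simp only [Nat.card_eq_fintype_card, Fintype.card_subtype, Finset.card_filter]
  exact Finset.sum_comm

/-- **Cor. 18.5.12 with (18.5.8), arithmetic form: `Σ_{c ∈ Cls O} z(c) = 2^{#T} · #Typ O`** for `T ⊇ primes(N⁺N⁻)`, where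
`z(c) = #{g ∈ (ℤ/2ℤ)^T : ∃ x ∈ O_L(I_c) P_{supp g}(O_L(I_c)), nrd x = ∏ localNorm}` (`= [N(O') : ℚ^×O'^×]`; grouping the
fibres, `Σ_{[O']} #fibre · z_{O'} = Σ_{[O']} #Pic`). [cite: Voight2021, Cor. 18.5.12 and (18.5.8)] -/
theorem XiSetup.sum_natCard_norm_eq_two_pow_mul_natCard_typeSet [Fintype (ClassSet S.O)]
    (hT : (Nplus * Nminus).primeFactors ⊆ T) (hTp : ∀ r ∈ T, r.Prime) :
    ∑ c : ClassSet S.O, Nat.card {g : T → Multiplicative (ZMod 2) //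
        ∃ x ∈ leftOrder c.rep * S.twoSidedIdealProd (leftOrder c.rep) (suppSort T g),
          reducedNorm ℚ S.D x = (((suppSort T g).map (localNorm Nplus Nminus)).prod : ℕ)} =
      2 ^ T.card * Nat.card (TypeSet S.O) := by
  have hc : ∀ c : ClassSet S.O, Nat.card {g : T → Multiplicative (ZMod 2) //
      ∃ x ∈ leftOrder c.rep * S.twoSidedIdealProd (leftOrder c.rep) (suppSort T g),
        reducedNorm ℚ S.D x = (((suppSort T g).map (localNorm Nplus Nminus)).prod : ℕ)} =
      Nat.card {g : T → Multiplicative (ZMod 2) // S.atkinLehnerHom T g c = c} := fun c =>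
    Nat.card_congr (Equiv.subtypeEquivRight fun g =>
      (S.atkinLehnerHom_apply_eq_self_iff_exists_reducedNorm_eq T hTp g c (nodup_suppSort T g) (mem_suppSort_iff T g)).symm)
  rw [Finset.sum_congr rfl fun c _ => hc c, S.sum_natCard_stabilizer_eq_sum_natCard_fixedPoints₅₇ T,
    S.sum_natCard_fixedPoints_atkinLehnerHom T, S.natCard_sClassSet_eq_natCard_typeSet T hT]

/-! ## §4 Admissibility in arithmetic form; Martin's Proposition 7 over the type set -/

/-- **The `T`-class of `c` is `χ`-admissible iff `χ(g) = 1` for every `g` whose admissible product `P_{supp g}(O_L(I_c))`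
contains an element of reduced norm `∏_{supp g} localNorm`** (`T` a finite set of primes).
[cite: Martin2018, §4.4 Prop. 7] [cite: Voight2021, Lemma 18.5.1 and Prop. 18.5.10] -/
theorem XiSetup.isAdmissible_sClassOf_iff_forall_norm (hTp : ∀ r ∈ T, r.Prime) (χ : T → ℤˣ) (c : ClassSet S.O) :
    S.IsAdmissible T χ (S.sClassOf T c) ↔
      ∀ g : T → Multiplicative (ZMod 2),
        (∃ x ∈ leftOrder c.rep * S.twoSidedIdealProd (leftOrder c.rep) (suppSort T g),
          reducedNorm ℚ S.D x = (((suppSort T g).map (localNorm Nplus Nminus)).prod : ℕ)) → signCharacter T χ g = 1 := by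
  rw [S.isAdmissible_iff_forall_stabilizer χ c]
  refine forall_congr' fun g => ?_
  rw [S.atkinLehnerHom_apply_eq_self_iff_exists_reducedNorm_eq T hTp g c (nodup_suppSort T g) (mem_suppSort_iff T g)]

/-- Admissibility of the `T`-class of `c` depends only on the type of `c`. [cite: Martin2018, §4.4 Prop. 7] [cite: Voight2021, Prop. 18.5.10] -/
theorem XiSetup.isAdmissible_sClassOf_iff_of_typeOf_eq {c c' : ClassSet S.O} (h : typeOf S.O c = typeOf S.O c') (χ : T → ℤˣ) :
    S.IsAdmissible T χ (S.sClassOf T c) ↔ S.IsAdmissible T χ (S.sClassOf T c') := by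
  rw [S.isAdmissible_iff_forall_stabilizer χ c, S.isAdmissible_iff_forall_stabilizer χ c']
  exact forall_congr' fun g => by rw [S.atkinLehnerHom_apply_eq_self_iff_of_typeOf_eq T h g]

/-- **MARTIN'S PROPOSITION 7 OVER THE TYPE SET: for `T ⊇ primes(N⁺N⁻)`,
`dim M^χ(O) = #{t ∈ Typ O : χ(g) = 1 whenever, for a class c of type t, O_L(I_c) P_{supp g}(O_L(I_c)) contains an element
of reduced norm ∏_{supp g} localNorm}`** — the sign space `M^χ(O)` has one dimension for each isomorphism class of orders `O'`
in the genus of `O` on whose principal admissible two-sided ideals `χ` is trivial.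
[cite: Martin2018, §4.4 Prop. 7] [cite: Voight2021, Prop. 18.5.10 and Cor. 18.5.12] -/
theorem XiSetup.finrank_signSpace_eq_natCard_typeSet_norm (hT : (Nplus * Nminus).primeFactors ⊆ T) (hTp : ∀ r ∈ T, r.Prime)
    (χ : T → ℤˣ) :
    Module.finrank ℚ (S.signSpace T χ) =
      Nat.card {t : TypeSet S.O // ∀ c : ClassSet S.O, typeOf S.O c = t → ∀ g : T → Multiplicative (ZMod 2),
        (∃ x ∈ leftOrder c.rep * S.twoSidedIdealProd (leftOrder c.rep) (suppSort T g),
          reducedNorm ℚ S.D x = (((suppSort T g).map (localNorm Nplus Nminus)).prod : ℕ)) → signCharacter T χ g = 1} := by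
  rw [S.finrank_signSpace_eq_natCard_isAdmissible χ]
  obtain ⟨e, he⟩ := S.exists_equiv_sClassSet_typeSet T hT
  refine Nat.card_congr (e.subtypeEquiv fun X => ?_)
  obtain ⟨c₀, rfl⟩ := S.sClassOf_surjective T X
  rw [he c₀, S.isAdmissible_sClassOf_iff_forall_norm T hTp χ c₀]
  constructor
  · intro h c hc g hg
    exact h g ((S.exists_norm_iff_of_typeOf_eq (fun _ hr => prime_of_mem_suppSort T hTp g hr) (nodup_suppSort T g) hc).mp hg)
  · exact fun h => h c₀ rfl

/-- **`dim M^χ(O) ≤ #Typ O`** for `T ⊇ primes(N⁺N⁻)` (with equality iff every type is `χ`-admissible, e.g. `χ = +_T`).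
[cite: Martin2018, §4.4 Prop. 7 and (3.9)] [cite: Voight2021, Cor. 18.5.12] -/
theorem XiSetup.finrank_signSpace_le_natCard_typeSet (hT : (Nplus * Nminus).primeFactors ⊆ T) (hTp : ∀ r ∈ T, r.Prime)
    (χ : T → ℤˣ) : Module.finrank ℚ (S.signSpace T χ) ≤ Nat.card (TypeSet S.O) := by
  haveI : Finite (TypeSet S.O) := S.finite_typeSet
  rw [S.finrank_signSpace_eq_natCard_typeSet_norm T hT hTp χ]
  exact Finite.card_subtype_le _

/-! ## §5 The principal type: the classes `[I]` with `O_L(I) ≃ O` -/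

/-- **`(W_{r_k} ∘ ⋯ ∘ W_{r_1}) [O] = [O] ⟺ ∃ x ∈ O P_l(O)` with `nrd x = ∏_{r ∈ l} localNorm r`** (`l` a duplicate-free list of
primes): the stabiliser of the trivial class read on `O` itself. [cite: Voight2021, Lemma 18.5.1 and Prop. 18.5.10] -/
theorem XiSetup.foldl_atkinLehner_mk_self_eq_self_iff_exists_norm {l : List ℕ} (hl : ∀ r ∈ l, r.Prime) (hnd : l.Nodup) :
    l.foldl (fun c r => S.atkinLehner r c) (Quotient.mk (rightClassSetoid S.O) ⟨S.O, S.self_mem_rightIdeals⟩) =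
        Quotient.mk (rightClassSetoid S.O) ⟨S.O, S.self_mem_rightIdeals⟩ ↔
      ∃ x ∈ S.O * S.twoSidedIdealProd S.O l, reducedNorm ℚ S.D x = ((l.map (localNorm Nplus Nminus)).prod : ℕ) := by
  rw [S.foldl_atkinLehner_mk_eq_self_iff hl ⟨S.O, S.self_mem_rightIdeals⟩,
    show leftOrder (((⟨S.O, S.self_mem_rightIdeals⟩ : rightIdeals S.O)) : Submodule ℤ S.D) = S.O from
      S.isEichlerOrder.isOrder.leftOrder_eq]
  exact S.exists_order_mul_twoSidedIdealProd_eq_units_smul_iff hl hnd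

/-- **For a class `c` of the principal type (`O_L(I_c) ≃ O`), `O_L(I_c) P_l(O_L(I_c))` contains an element of reduced norm
`∏ localNorm` iff `O P_l(O)` does.** [cite: Voight2021, Lemma 18.5.1 and Prop. 18.5.10] -/
theorem XiSetup.exists_norm_iff_of_typeOf_eq_typeOf_mk_self {l : List ℕ} (hl : ∀ r ∈ l, r.Prime) (hnd : l.Nodup)
    {c : ClassSet S.O} (h : typeOf S.O c = typeOf S.O (Quotient.mk (rightClassSetoid S.O) ⟨S.O, S.self_mem_rightIdeals⟩)) :
    (∃ x ∈ leftOrder c.rep * S.twoSidedIdealProd (leftOrder c.rep) l,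
        reducedNorm ℚ S.D x = ((l.map (localNorm Nplus Nminus)).prod : ℕ)) ↔
      ∃ x ∈ S.O * S.twoSidedIdealProd S.O l, reducedNorm ℚ S.D x = ((l.map (localNorm Nplus Nminus)).prod : ℕ) := by
  rw [← S.foldl_atkinLehner_eq_self_iff_exists_reducedNorm_eq hl hnd c,
    ← S.foldl_atkinLehner_mk_self_eq_self_iff_exists_norm hl hnd]
  exact S.foldl_atkinLehner_eq_self_iff_of_typeOf_eq h l

/-- **THE CLASSES OF THE PRINCIPAL TYPE ARE THE CLASSES OF THE ADMISSIBLE TWO-SIDED IDEALS: `O_L(I_c) ≃ O ⟺ c = [O P_{supp g}(O)]`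
for some `g ∈ (ℤ/2ℤ)^T`** (`T ⊇ primes(N⁺N⁻)`; Voight's surjection `J' ↦ [J' I]` of Prop. 18.5.10 at `I = O`).
[cite: Voight2021, Prop. 18.5.10 and (23.4.20)] -/
theorem XiSetup.typeOf_eq_typeOf_mk_self_iff_exists (hT : (Nplus * Nminus).primeFactors ⊆ T) (hTp : ∀ r ∈ T, r.Prime)
    (c : ClassSet S.O) :
    typeOf S.O c = typeOf S.O (Quotient.mk (rightClassSetoid S.O) ⟨S.O, S.self_mem_rightIdeals⟩) ↔
      ∃ g : T → Multiplicative (ZMod 2), c = Quotient.mk (rightClassSetoid S.O)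
        ⟨S.O * S.twoSidedIdealProd S.O (suppSort T g),
          S.mul_twoSidedIdealProd_mem (fun _ hr => prime_of_mem_suppSort T hTp g hr) S.self_mem_rightIdeals⟩ := by
  rw [eq_comm, ← S.sClassOf_eq_sClassOf_iff_typeOf_eq T hT, S.sClassOf_eq_sClassOf_iff_exists_atkinLehnerHom T]
  refine exists_congr fun g => ?_
  rw [S.atkinLehnerHom_apply_eq_foldl T g _ (nodup_suppSort T g) (mem_suppSort_iff T g),
    S.foldl_atkinLehner_mk (fun _ hr => prime_of_mem_suppSort T hTp g hr) ⟨S.O, S.self_mem_rightIdeals⟩, eq_comm]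

/-- **`#{c : O_L(I_c) ≃ O} · #{g ∈ (ℤ/2ℤ)^T : ∃ x ∈ O P_{supp g}(O), nrd x = ∏ localNorm} = 2^{#T}`** for `T ⊇ primes(N⁺N⁻)`:
the number of right ideal classes whose left order is isomorphic to `O` is `#(PIdl(O) \ Idl(O)) = 2^{ω(N⁺N⁻)} / [N(O) : ℚ^×O^×]`.
[cite: Voight2021, (18.5.8), Prop. 18.5.3 and Prop. 18.5.10] -/
theorem XiSetup.natCard_principalType_mul_natCard_norm_eq_two_pow (hT : (Nplus * Nminus).primeFactors ⊆ T)
    (hTp : ∀ r ∈ T, r.Prime) :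
    Nat.card {c : ClassSet S.O // typeOf S.O c = typeOf S.O (Quotient.mk (rightClassSetoid S.O) ⟨S.O, S.self_mem_rightIdeals⟩)} *
        Nat.card {g : T → Multiplicative (ZMod 2) //
          ∃ x ∈ S.O * S.twoSidedIdealProd S.O (suppSort T g),
            reducedNorm ℚ S.D x = (((suppSort T g).map (localNorm Nplus Nminus)).prod : ℕ)} = 2 ^ T.card := by
  rw [← S.natCard_fibre_mul_natCard_norm_eq_two_pow T hT hTp (Quotient.mk (rightClassSetoid S.O) ⟨S.O, S.self_mem_rightIdeals⟩)]
  congr 1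
  exact Nat.card_congr (Equiv.subtypeEquivRight fun g => (S.exists_norm_iff_of_typeOf_eq_typeOf_mk_self
    (fun _ hr => prime_of_mem_suppSort T hTp g hr) (nodup_suppSort T g) rfl).symm)

/-- **`#{c : O_L(I_c) ≃ O} = 2^{#T}` iff `O` has no principal non-empty admissible product, and `= 1` iff all its admissible
products are principal.** [cite: Voight2021, (18.5.8), Prop. 18.5.3 and Prop. 18.5.10] -/
theorem XiSetup.natCard_principalType_eq_one_iff_forall_exists_norm (hT : (Nplus * Nminus).primeFactors ⊆ T)
    (hTp : ∀ r ∈ T, r.Prime) :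
    Nat.card {c : ClassSet S.O // typeOf S.O c = typeOf S.O (Quotient.mk (rightClassSetoid S.O) ⟨S.O, S.self_mem_rightIdeals⟩)} = 1 ↔
      ∀ g : T → Multiplicative (ZMod 2),
        ∃ x ∈ S.O * S.twoSidedIdealProd S.O (suppSort T g),
          reducedNorm ℚ S.D x = (((suppSort T g).map (localNorm Nplus Nminus)).prod : ℕ) := by
  rw [S.natCard_fibre_typeOf_eq_one_iff_forall_exists_norm T hT hTp]
  exact forall_congr' fun g => S.exists_norm_iff_of_typeOf_eq_typeOf_mk_self
    (fun _ hr => prime_of_mem_suppSort T hTp g hr) (nodup_suppSort T g) rfl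

/-! ## §6 Eichler's class number as a sum over the types (Voight Cor. 18.5.12, second form) -/

/-- `#Stab(c) = z(c)` (the stabiliser counted arithmetically). [cite: Voight2021, Prop. 18.5.3] -/
private theorem XiSetup.natCard_stabilizer_eq_natCard_norm₅₈ (hTp : ∀ r ∈ T, r.Prime) (c : ClassSet S.O) :
    Nat.card {g : T → Multiplicative (ZMod 2) // S.atkinLehnerHom T g c = c} =
      Nat.card {g : T → Multiplicative (ZMod 2) //
        ∃ x ∈ leftOrder c.rep * S.twoSidedIdealProd (leftOrder c.rep) (suppSort T g),
          reducedNorm ℚ S.D x = (((suppSort T g).map (localNorm Nplus Nminus)).prod : ℕ)} :=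
  Nat.card_congr (Equiv.subtypeEquivRight fun g =>
    S.atkinLehnerHom_apply_eq_self_iff_exists_reducedNorm_eq T hTp g c (nodup_suppSort T g) (mem_suppSort_iff T g))

/-- **`#{c : typeOf c = t} · z_t = 2^{#T}`** with the type invariant `z_t = #{g ∈ (ℤ/2ℤ)^T : for every (equivalently: some) class
`c` of type `t`, `O_L(I_c) P_{supp g}(O_L(I_c))` contains an element of reduced norm `∏ localNorm}` (`= [N(O') : ℚ^×O'^×]` for the
orders `O'` of type `t`), `T ⊇ primes(N⁺N⁻)`. [cite: Voight2021, (18.5.8), Prop. 18.5.3 and Prop. 18.5.10] -/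
theorem XiSetup.natCard_fibre_mul_natCard_typeNorm_eq_two_pow (hT : (Nplus * Nminus).primeFactors ⊆ T) (hTp : ∀ r ∈ T, r.Prime)
    (t : TypeSet S.O) :
    Nat.card {c : ClassSet S.O // typeOf S.O c = t} *
        Nat.card {g : T → Multiplicative (ZMod 2) // ∀ c : ClassSet S.O, typeOf S.O c = t →
          ∃ x ∈ leftOrder c.rep * S.twoSidedIdealProd (leftOrder c.rep) (suppSort T g),
            reducedNorm ℚ S.D x = (((suppSort T g).map (localNorm Nplus Nminus)).prod : ℕ)} = 2 ^ T.card := by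
  obtain ⟨c₀, rfl⟩ := typeOf_surjective t
  rw [← S.natCard_fibre_mul_natCard_norm_eq_two_pow T hT hTp c₀]
  congr 1
  exact Nat.card_congr (Equiv.subtypeEquivRight fun g =>
    ⟨fun h => h c₀ rfl, fun h c hc =>
      (S.exists_norm_iff_of_typeOf_eq (fun _ hr => prime_of_mem_suppSort T hTp g hr) (nodup_suppSort T g) hc).mpr h⟩)

/-- The type invariant `z_t` is positive (`g = 0` always qualifies). [cite: Voight2021, Prop. 18.5.3] -/
theorem XiSetup.natCard_typeNorm_pos (hT : (Nplus * Nminus).primeFactors ⊆ T) (hTp : ∀ r ∈ T, r.Prime) (t : TypeSet S.O) :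
    0 < Nat.card {g : T → Multiplicative (ZMod 2) // ∀ c : ClassSet S.O, typeOf S.O c = t →
          ∃ x ∈ leftOrder c.rep * S.twoSidedIdealProd (leftOrder c.rep) (suppSort T g),
            reducedNorm ℚ S.D x = (((suppSort T g).map (localNorm Nplus Nminus)).prod : ℕ)} := by
  refine Nat.pos_of_ne_zero fun h0 => ?_
  have key := S.natCard_fibre_mul_natCard_typeNorm_eq_two_pow T hT hTp t
  rw [h0, mul_zero] at key
  exact absurd key (pow_pos two_pos _).ne

/-- **VOIGHT COR. 18.5.12 ∕ EICHLER: `#Cls O = Σ_{t ∈ Typ O} 2^{#T} / z_t`** (`= #Pic(O) · Σ_{[O']} 1/z_{O'}` at `T = primes(N⁺N⁻)`,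
`#Pic(O) = 2^{ω(N⁺N⁻)}`, `z_{O'} = [N(O') : ℚ^×O'^×]` counted as the principal admissible products of `O'`). [cite: Voight2021, Cor. 18.5.12 and (18.5.8)] -/
theorem XiSetup.natCard_classSet_eq_sum_two_pow_div_natCard_typeNorm [Fintype (ClassSet S.O)] [Fintype (TypeSet S.O)]
    (hT : (Nplus * Nminus).primeFactors ⊆ T) (hTp : ∀ r ∈ T, r.Prime) :
    (Nat.card (ClassSet S.O) : ℚ) = ∑ t : TypeSet S.O, (2 : ℚ) ^ T.card /
      Nat.card {g : T → Multiplicative (ZMod 2) // ∀ c : ClassSet S.O, typeOf S.O c = t →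
        ∃ x ∈ leftOrder c.rep * S.twoSidedIdealProd (leftOrder c.rep) (suppSort T g),
          reducedNorm ℚ S.D x = (((suppSort T g).map (localNorm Nplus Nminus)).prod : ℕ)} := by
  rw [S.natCard_classSet_eq_sum_natCard_fibre, Nat.cast_sum]
  refine Finset.sum_congr rfl fun t _ => ?_
  have key := S.natCard_fibre_mul_natCard_typeNorm_eq_two_pow T hT hTp t
  have hz : (Nat.card {g : T → Multiplicative (ZMod 2) // ∀ c : ClassSet S.O, typeOf S.O c = t →
      ∃ x ∈ leftOrder c.rep * S.twoSidedIdealProd (leftOrder c.rep) (suppSort T g),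
        reducedNorm ℚ S.D x = (((suppSort T g).map (localNorm Nplus Nminus)).prod : ℕ)} : ℚ) ≠ 0 :=
    Nat.cast_ne_zero.mpr (S.natCard_typeNorm_pos T hT hTp t).ne'
  rw [eq_div_iff hz]
  exact_mod_cast key

/-- **`#Cls O = 2^{#T} · #Typ O` iff no left order `O_L(I_c)` has a principal non-empty admissible product** (`T ⊇ primes(N⁺N⁻)`;
the upper bound `h ≤ 2^{ω(N)} t` is attained iff every `z_{O'} = 1`). [cite: Voight2021, Cor. 18.5.12] [cite: Martin2018, §2 (`h_B ≤ 2^{ω(𝔑)} t_B`)] -/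
theorem XiSetup.natCard_classSet_eq_two_pow_mul_natCard_typeSet_iff [Fintype (ClassSet S.O)]
    (hT : (Nplus * Nminus).primeFactors ⊆ T) (hTp : ∀ r ∈ T, r.Prime) :
    Nat.card (ClassSet S.O) = 2 ^ T.card * Nat.card (TypeSet S.O) ↔
      ∀ c : ClassSet S.O, ∀ g : T → Multiplicative (ZMod 2), g ≠ 1 →
        ¬ ∃ x ∈ leftOrder c.rep * S.twoSidedIdealProd (leftOrder c.rep) (suppSort T g),
            reducedNorm ℚ S.D x = (((suppSort T g).map (localNorm Nplus Nminus)).prod : ℕ) := by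
  classical
  -- `h = Σ_c 1`, `2^{#T} t = Σ_c z(c)` with every `z(c) ≥ 1`: equality iff every `z(c) = 1`
  have hsum := S.sum_natCard_norm_eq_two_pow_mul_natCard_typeSet T hT hTp
  have h1P : ∀ c : ClassSet S.O, (fun g' : T → Multiplicative (ZMod 2) => S.atkinLehnerHom T g' c = c) 1 := fun c => by
    show S.atkinLehnerHom T 1 c = c
    rw [map_one, Equiv.Perm.coe_one, id_eq]
  have hz1 : ∀ c : ClassSet S.O, 1 ≤ Nat.card {g : T → Multiplicative (ZMod 2) //
      ∃ x ∈ leftOrder c.rep * S.twoSidedIdealProd (leftOrder c.rep) (suppSort T g),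
        reducedNorm ℚ S.D x = (((suppSort T g).map (localNorm Nplus Nminus)).prod : ℕ)} := fun c => by
    rw [← S.natCard_stabilizer_eq_natCard_norm₅₈ T hTp c]
    exact S.natCard_stabilizer_pos₅₇ T c
  have hcard : Nat.card (ClassSet S.O) = ∑ _c : ClassSet S.O, 1 := by
    rw [Finset.sum_const, smul_eq_mul, mul_one, Finset.card_univ, Nat.card_eq_fintype_card]
  -- `z(c) = 1 ⟺` no `g ≠ 1` qualifies
  have hiff : ∀ c : ClassSet S.O, Nat.card {g : T → Multiplicative (ZMod 2) //
      ∃ x ∈ leftOrder c.rep * S.twoSidedIdealProd (leftOrder c.rep) (suppSort T g),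
        reducedNorm ℚ S.D x = (((suppSort T g).map (localNorm Nplus Nminus)).prod : ℕ)} = 1 ↔
      ∀ g : T → Multiplicative (ZMod 2), g ≠ 1 →
        ¬ ∃ x ∈ leftOrder c.rep * S.twoSidedIdealProd (leftOrder c.rep) (suppSort T g),
            reducedNorm ℚ S.D x = (((suppSort T g).map (localNorm Nplus Nminus)).prod : ℕ) := fun c => by
    rw [← S.natCard_stabilizer_eq_natCard_norm₅₈ T hTp c, natCard_subtype_eq_one_iff₅₇ (h1P c)]
    refine forall_congr' fun g => ?_
    rw [S.atkinLehnerHom_apply_eq_self_iff_exists_reducedNorm_eq T hTp g c (nodup_suppSort T g) (mem_suppSort_iff T g)]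
    exact ⟨fun h hg hx => hg (h hx), fun h hx => by_contra fun hg => h hg hx⟩
  rw [← hsum, hcard]
  constructor
  · intro h c
    exact (hiff c).mp ((Finset.sum_eq_sum_iff_of_le fun c _ => hz1 c).mp h c (Finset.mem_univ c)).symm
  · intro h
    exact Finset.sum_congr rfl fun c _ => ((hiff c).mpr (h c)).symm

end Brandt

end Literature.NumberTheory.Automorphic
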